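import Literature.AnabelianGeometry.AbsoluteAnabelian.AbsTopIII.EquivariantUnitExponents
import Literature.AnabelianGeometry.AbsoluteAnabelian.MLFGaloisModelPairs
import HarnessLib

/-!
# [AbsTopIII] Prop 3.3 (ii) `TCG` at the model, III: the `Gal(k̄/k)`-equivariant ENDOMORPHISMS of `𝒪_k̄^×`
# are exactly the `Ẑ`-powers

Proof-only sequel (theorems only, no definitions) of `EquivariantUnitAutomorphisms.lean` /
`EquivariantUnitExponents.lean` (S. Mochizuki, *Topics in Absolute Anabelian Geometry III*, Def. 3.1 (ii) p. 67
— morphisms of MLF-Galois `TCG`-pairs `(Π ↷ 𝒪_k̄^×)` — and Prop. 3.3 (ii) p. 74: for `T = TCG` the map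
`Isom((Π ↷ M),(Π* ↷ M*)) → Isom(Π,Π*) × Isom(μ_Ẑ(M), μ_Ẑ(M*))` "is a bijection"; *Inter-universal Teichmüller
Theory II*, Rmk. 1.11.1 (i)(b) p. 50; kurims manuscripts, lit keys `paper:url-5493eb38cbb7`,
`paper:url-5036b4059555`; typer of this file: abc-iut-L4-t2 gen 11).

Those two files prove: the equivariant AUTOMORPHISMS of `𝒪_k̄^× = unitSubmonoid k k̄` over `id_{G_k}` are exactly
the `Ẑ^×`-powers.  This file removes the invertibility: the equivariant ENDOMORPHISMS (`→*`) over `id_{G_k}` are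
exactly the `Ẑ`-powers — the `TCG` member of the trilogy `End_{id}((G_k ↷ 𝒪_k̄^⊳)) = ℕ`
(`MonoidKummerEndomorphismsArePowers`), `End_{id}((G_k ↷ k̄^×)) = ℤ` (`MLFGaloisUnitsEndomorphismsArePowers`),
`End_{id}((G_k ↷ 𝒪_k̄^×)) = Ẑ` (here), with unit groups `{1}`, `{±1}`, `Ẑ^×` = the printed fibres of
Prop. 3.2 (iv) / 3.3 (ii):

* `MLFClosure.equivariant_unitHom_eq_of_rootsOfUnity` — UNIQUENESS for endomorphisms: two equivariant
  `β₁, β₂ : 𝒪_k̄^× →* 𝒪_k̄^×` that agree on all roots of unity coincide.  Trick: `x ↦ β₁(x)·β₂(x)⁻¹·x` is an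
  equivariant endomorphism FIXING `μ_∞`, hence the identity by abc-iut-L6-t21's rigidity engine
  `MLFClosure.submonoid_equivariant_eq_self` — no inverse of `βᵢ` is needed (the `≃*` version is
  `MLFClosure.equivariant_unitMulEquiv_eq_of_rootsOfUnity`);
* `MLFClosure.equivariant_unitHom_exponents` — every `β : 𝒪_k̄^× →* 𝒪_k̄^×` acts on the roots of unity through a
  COMPATIBLE exponent system `a` (`a n ≡ a m (mod m)` for `m ∣ n`; no longer a unit system);
* `MLFClosure.equivariant_unitHom_eq_zhatPow` — hence every equivariant endomorphism IS the `Ẑ`-power `x ↦ x^a`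
  of `MLFClosure.exists_equivariant_unitHom_of_compatible` (`β x ∈ x^{a n}·(k⟮x⟯^×)^n` for all `n`), and two
  equivariant endomorphisms with congruent exponent systems are equal
  (`MLFClosure.equivariant_unitHom_eq_of_exponents_modEq`) — `End_{id}((G_k ↷ 𝒪_k̄^×)) ≅ Ẑ = lim ℤ/n`;
* `MLFClosure.equivariant_unitHom_bijective_iff_coprime` — such a `β` is bijective iff its exponent system is a
  UNIT system (`a n` prime to `n` for all `n`): `Aut = Ẑ^× ⊂ Ẑ = End`;
* §2, the same for ENDOMORPHISMS `φ = (φ_Π, φ_M)` of the model `TCG`-pair `D.tcgPair = (Π_k ↷ 𝒪_k̄^×)`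
  (`MLFGaloisModelPairs.lean`) in the typed category `𝒞^MLF_TCG` of Def. 3.1 (ii) COVERING THE IDENTITY of `G_k`
  (`ε ∘ φ_Π = ε`): `GaloisMonoidPair.Hom.tcg_homM_equivariant_of_overId`, `…tcg_exists_exponents_of_overId` (`φ_M`
  is a `Ẑ`-power), `…tcg_homM_eq_of_rootsOfUnity_of_overId` (`End ↪ Ẑ`), `…tcg_isTIso_iff_coprime_of_overId`
  (`φ` is a `T`-isomorphism iff its exponent system is a unit system) — companions of the `TLG` statements
  `GaloisMonoidPair.Hom.tlg_*` of `MLFGaloisUnitsEndomorphismsCorollaries.lean` and of the `TM` statements of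
  `MonoidKummerGaloisCyclotomeHomOverId.lean` (abc-iut-L4-t2 gen 10).

HONEST FRAMING: OUR kernel check of classical statements over a `p`-adic field; count-neutral for the node
Prop. 3.3 (ii) (discharged of record); nothing here bears on [IUTchIII] Cor. 3.12; no side is taken; nothing
asserts that abc is proved or refuted.
-/

noncomputable section

namespace Literature.AnabelianGeometry.AbsoluteAnabelian

open _root_.ValuativeRel
open scoped IntermediateField

universe u

variable (C : MLFClosure.{u})

/-- `𝒪_k̄^×` is stable under inversion (from the definition: the partner `y` with `x y = 1` is `x⁻¹`).
[cite: MochizukiAbsTopIII2015, Definition 3.1 (i) p.66] -/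
private theorem MLFClosure.inv_mem_unitSubmonoid' {x : C.K} (hx : x ∈ unitSubmonoid C.k C.K) :
    x⁻¹ ∈ unitSubmonoid C.k C.K := by
  obtain ⟨hxi, y, hyi, hxy⟩ := hx
  have hy : y = x⁻¹ := eq_inv_of_mul_eq_one_right hxy
  refine ⟨hy ▸ hyi, x, hxi, ?_⟩
  rw [mul_comm, ← hy, hxy]

/-! ### Uniqueness: an equivariant endomorphism is determined by its action on `μ_∞` -/

/-- **Uniqueness for ENDOMORPHISMS.**  Two `Gal(k̄/k)`-equivariant multiplicative endomorphisms of `𝒪_k̄^×`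
that agree on all roots of unity coincide: `End_{id}((G_k ↷ 𝒪_k̄^×)) ↪ End(μ_∞(k̄)) = Ẑ` (the endomorphism
form of the injectivity «`Isom ↪ Isom(Π,Π*) × Isom(μ_Ẑ(M), μ_Ẑ(M*))`» at `Π`-component `id`).  Proof: the map
`x ↦ β₁(x)·β₂(x)⁻¹·x` is an equivariant endomorphism of `𝒪_k̄^×` fixing every root of unity, hence the identity
(`MLFClosure.submonoid_equivariant_eq_self`). [cite: MochizukiAbsTopIII2015, Proposition 3.3 (ii) p.74] -/
theorem MLFClosure.equivariant_unitHom_eq_of_rootsOfUnity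
    (β₁ β₂ : unitSubmonoid C.k C.K →* unitSubmonoid C.k C.K)
    (h₁ : ∀ (σ : C.K ≃ₐ[C.k] C.K) (x y : unitSubmonoid C.k C.K), (y : C.K) = σ x →
      ((β₁ y : unitSubmonoid C.k C.K) : C.K) = σ ((β₁ x : unitSubmonoid C.k C.K) : C.K))
    (h₂ : ∀ (σ : C.K ≃ₐ[C.k] C.K) (x y : unitSubmonoid C.k C.K), (y : C.K) = σ x →
      ((β₂ y : unitSubmonoid C.k C.K) : C.K) = σ ((β₂ x : unitSubmonoid C.k C.K) : C.K))
    (hμ : ∀ (x : unitSubmonoid C.k C.K) (m : ℕ), 0 < m → (x : C.K) ^ m = 1 → β₁ x = β₂ x) :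
    β₁ = β₂ := by
  classical
  have hM : ∀ (σ : C.K ≃ₐ[C.k] C.K) (x : C.K), x ∈ unitSubmonoid C.k C.K → σ x ∈ unitSubmonoid C.k C.K :=
    fun σ x hx => smul_mem_unitSubmonoid σ hx
  have hroot : ∀ x ∈ unitSubmonoid C.k C.K, ∀ n : ℕ, 0 < n → ∃ y ∈ unitSubmonoid C.k C.K, y ^ n = x :=
    fun x hx n hn => C.exists_unit_nthRoot hx hn
  have hμM : ∀ (ζ : C.K) (n : ℕ), 0 < n → ζ ^ n = 1 → ζ ∈ unitSubmonoid C.k C.K :=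
    fun ζ n hn hζ => C.rootOfUnity_mem_unitSubmonoid hn hζ
  have h0 : (0 : C.K) ∉ unitSubmonoid C.k C.K := fun h => C.ne_zero_of_mem_unitSubmonoid h rfl
  have hne : ∀ x : unitSubmonoid C.k C.K, (x : C.K) ≠ 0 := fun x =>
    C.ne_zero_of_mem_unitSubmonoid x.2
  -- `δ x := β₁ x · (β₂ x)⁻¹ · x`
  let δ : unitSubmonoid C.k C.K →* unitSubmonoid C.k C.K :=
    { toFun := fun x => ⟨((β₁ x : unitSubmonoid C.k C.K) : C.K) * (((β₂ x : unitSubmonoid C.k C.K) : C.K))⁻¹ *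
          (x : C.K),
        mul_mem (mul_mem (β₁ x).2 (C.inv_mem_unitSubmonoid' (β₂ x).2)) x.2⟩
      map_one' := Subtype.ext (by simp)
      map_mul' := fun a b => Subtype.ext (by
        simp only [map_mul, Submonoid.coe_mul, mul_inv]
        ring) }
  have hδ : ∀ x : unitSubmonoid C.k C.K, ((δ x : unitSubmonoid C.k C.K) : C.K) =
      ((β₁ x : unitSubmonoid C.k C.K) : C.K) * (((β₂ x : unitSubmonoid C.k C.K) : C.K))⁻¹ * (x : C.K) :=
    fun x => rfl
  have hδσ : ∀ (σ : C.K ≃ₐ[C.k] C.K) (x : unitSubmonoid C.k C.K),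
      ((δ ⟨σ x, hM σ x x.2⟩ : unitSubmonoid C.k C.K) : C.K) = σ ((δ x : unitSubmonoid C.k C.K) : C.K) := by
    intro σ x
    rw [hδ, hδ, h₁ σ x ⟨σ x, hM σ x x.2⟩ rfl, h₂ σ x ⟨σ x, hM σ x x.2⟩ rfl, map_mul, map_mul, map_inv₀]
  have hδμ : ∀ (x : unitSubmonoid C.k C.K) (n : ℕ), 0 < n → (x : C.K) ^ n = 1 → δ x = x := by
    intro x n hn hxn
    apply Subtype.ext
    rw [hδ, hμ x n hn hxn, mul_inv_cancel₀ (hne (β₂ x)), one_mul]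
  have hδid := C.submonoid_equivariant_eq_self (unitSubmonoid C.k C.K) hM hroot hμM h0 δ hδσ hδμ
  refine MonoidHom.ext fun x => Subtype.ext ?_
  have h := congrArg Subtype.val (hδid x)
  rw [hδ] at h
  have h' : ((β₁ x : unitSubmonoid C.k C.K) : C.K) * (((β₂ x : unitSubmonoid C.k C.K) : C.K))⁻¹ = 1 :=
    mul_right_cancel₀ (hne x) (h.trans (one_mul _).symm)
  rwa [← div_eq_mul_inv, div_eq_one_iff_eq (hne (β₂ x))] at h'

/-! ### Exponents: an endomorphism acts on `μ_∞` through a compatible system (an element of `Ẑ`) -/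

/-- **Exponents (endomorphism version).**  Every multiplicative endomorphism `β` of `𝒪_k̄^×` acts on the roots of
unity through a COMPATIBLE exponent system: there is `a : ℕ → ℕ`, `a n ≡ a m (mod m)` for `m ∣ n`, with
`β ζ = ζ^{a m}` for every `m`-th root of unity (`μ_m` is cyclic; `β` maps `μ_m` into `μ_m`).  Compared with
`MLFClosure.equivariant_unitMulEquiv_exponents` the system need not be a unit system.  (Equivariance is not needed.)
[cite: MochizukiAbsTopIII2015, Proposition 3.3 (ii) p.74] -/
theorem MLFClosure.equivariant_unitHom_exponents
    (β : unitSubmonoid C.k C.K →* unitSubmonoid C.k C.K) :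
    ∃ a : ℕ → ℕ, (∀ m n : ℕ, 0 < m → 0 < n → m ∣ n → a n ≡ a m [MOD m]) ∧
      ∀ (x : unitSubmonoid C.k C.K) (m : ℕ), 0 < m → (x : C.K) ^ m = 1 →
        ((β x : unitSubmonoid C.k C.K) : C.K) = (x : C.K) ^ a m := by
  classical
  have hβpow : ∀ (x : unitSubmonoid C.k C.K) (i : ℕ),
      ((β (x ^ i) : unitSubmonoid C.k C.K) : C.K) = ((β x : unitSubmonoid C.k C.K) : C.K) ^ i := by
    intro x i; rw [map_pow, SubmonoidClass.coe_pow]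
  -- a primitive `n`-th root of unity `ζ n ∈ 𝒪_k̄^×` and the exponent of `β` on it
  have hprim : ∀ n : ℕ, 0 < n → ∃ z : unitSubmonoid C.k C.K, IsPrimitiveRoot (z : C.K) n ∧
      ∃ e : ℕ, ((β z : unitSubmonoid C.k C.K) : C.K) = (z : C.K) ^ e := by
    intro n hn
    haveI : NeZero n := ⟨hn.ne'⟩
    obtain ⟨ζ, hζ⟩ := C.exists_isPrimitiveRoot n hn
    set z : unitSubmonoid C.k C.K := ⟨ζ, C.rootOfUnity_mem_unitSubmonoid hn hζ.pow_eq_one⟩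
    have hzn : ((β z : unitSubmonoid C.k C.K) : C.K) ^ n = 1 := by
      rw [← hβpow, show z ^ n = 1 from Subtype.ext (by
        rw [SubmonoidClass.coe_pow]; exact hζ.pow_eq_one), map_one]; rfl
    obtain ⟨e, -, he⟩ := hζ.eq_pow_of_pow_eq_one hzn
    exact ⟨z, hζ, e, he.symm⟩
  choose z hz e he using hprim
  refine ⟨fun n => if hn : 0 < n then e n hn else 0, ?_, ?_⟩
  · -- compatibility
    intro m n hm hn hmn
    simp only [hm, hn, dif_pos]
    haveI : NeZero n := ⟨hn.ne'⟩
    have hzmm : ((z m hm : unitSubmonoid C.k C.K) : C.K) ^ m = 1 := (hz m hm).pow_eq_one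
    have hzm_n : ((z m hm : unitSubmonoid C.k C.K) : C.K) ^ n = 1 := by
      obtain ⟨c, rfl⟩ := hmn; rw [pow_mul, hzmm, one_pow]
    obtain ⟨i, -, hi⟩ := (hz n hn).eq_pow_of_pow_eq_one hzm_n
    have hzeq : z m hm = (z n hn) ^ i := Subtype.ext (by rw [SubmonoidClass.coe_pow, hi])
    have h1 : ((β (z m hm) : unitSubmonoid C.k C.K) : C.K) = (z m hm : C.K) ^ e n hn := by
      rw [hzeq, hβpow, he n hn, SubmonoidClass.coe_pow, ← pow_mul, ← pow_mul, mul_comm]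
    rw [he m hm] at h1
    have h2 : ((z m hm : unitSubmonoid C.k C.K) : C.K) ^ (e m hm % m) =
        ((z m hm : unitSubmonoid C.k C.K) : C.K) ^ (e n hn % m) := by
      rw [C.pow_eq_pow_of_modEq hzmm (Nat.mod_modEq _ m), C.pow_eq_pow_of_modEq hzmm (Nat.mod_modEq _ m)]
      exact h1
    exact ((hz m hm).pow_inj (Nat.mod_lt _ hm) (Nat.mod_lt _ hm) h2).symm
  · -- the formula on all roots of unity
    intro x m hm hxm
    simp only [hm, dif_pos]
    haveI : NeZero m := ⟨hm.ne'⟩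
    obtain ⟨i, -, hi⟩ := (hz m hm).eq_pow_of_pow_eq_one hxm
    have hxeq : x = (z m hm) ^ i := Subtype.ext (by rw [SubmonoidClass.coe_pow, hi])
    rw [hxeq, hβpow, he m hm, SubmonoidClass.coe_pow, ← pow_mul, ← pow_mul, mul_comm]

/-! ### The classification: `End_{id}((G_k ↷ 𝒪_k̄^×)) = Ẑ` -/

/-- **Every `Gal(k̄/k)`-equivariant endomorphism of `𝒪_k̄^×` is a `Ẑ`-power `x ↦ x^a`**: for its exponent system
`a` (compatible), `β ζ = ζ^{a m}` on `μ_m` and `β x ∈ x^{a n} · (k⟮x⟯^×)^n` for every `n ≥ 1` — `β` equals the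
map of `MLFClosure.exists_equivariant_unitHom_of_compatible a` by the endomorphism uniqueness.  With that
existence theorem: `End_{id}((G_k ↷ 𝒪_k̄^×))` is exactly the set of `Ẑ`-powers, `Ẑ = lim ℤ/n` read as compatible
exponent systems. [cite: MochizukiAbsTopIII2015, Proposition 3.3 (ii) p.74] -/
theorem MLFClosure.equivariant_unitHom_eq_zhatPow
    (β : unitSubmonoid C.k C.K →* unitSubmonoid C.k C.K)
    (hβ : ∀ (σ : C.K ≃ₐ[C.k] C.K) (x y : unitSubmonoid C.k C.K), (y : C.K) = σ x →
      ((β y : unitSubmonoid C.k C.K) : C.K) = σ ((β x : unitSubmonoid C.k C.K) : C.K)) :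
    ∃ a : ℕ → ℕ, (∀ m n : ℕ, 0 < m → 0 < n → m ∣ n → a n ≡ a m [MOD m]) ∧
      (∀ (x : unitSubmonoid C.k C.K) (m : ℕ), 0 < m → (x : C.K) ^ m = 1 →
        ((β x : unitSubmonoid C.k C.K) : C.K) = (x : C.K) ^ a m) ∧
      ∀ (x : unitSubmonoid C.k C.K) (n : ℕ), 0 < n → ∃ w ∈ C.k⟮(x : C.K)⟯, w ≠ 0 ∧
        ((β x : unitSubmonoid C.k C.K) : C.K) = (x : C.K) ^ a n * w ^ n := by
  obtain ⟨a, ha, hβa⟩ := C.equivariant_unitHom_exponents β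
  obtain ⟨β', hβ'σ, hβ'μ, hβ'pow⟩ := C.exists_equivariant_unitHom_of_compatible a ha
  have heq : β = β' := C.equivariant_unitHom_eq_of_rootsOfUnity β β' hβ hβ'σ
    (fun x m hm hxm => Subtype.ext (by rw [hβa x m hm hxm, hβ'μ x m hm hxm]))
  refine ⟨a, ha, hβa, fun x n hn => ?_⟩
  rw [heq]
  exact hβ'pow x n hn

/-- **Equality from congruent exponent systems**: two equivariant endomorphisms whose exponent systems `a₁, a₂`
(any functions with `βᵢ ζ = ζ^{aᵢ m}` on `μ_m`) satisfy `a₁ m ≡ a₂ m (mod m)` for all `m ≥ 1` are equal — the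
map `End_{id}((G_k ↷ 𝒪_k̄^×)) → Ẑ` is injective. [cite: MochizukiAbsTopIII2015, Proposition 3.3 (ii) p.74] -/
theorem MLFClosure.equivariant_unitHom_eq_of_exponents_modEq
    (β₁ β₂ : unitSubmonoid C.k C.K →* unitSubmonoid C.k C.K)
    (h₁ : ∀ (σ : C.K ≃ₐ[C.k] C.K) (x y : unitSubmonoid C.k C.K), (y : C.K) = σ x →
      ((β₁ y : unitSubmonoid C.k C.K) : C.K) = σ ((β₁ x : unitSubmonoid C.k C.K) : C.K))
    (h₂ : ∀ (σ : C.K ≃ₐ[C.k] C.K) (x y : unitSubmonoid C.k C.K), (y : C.K) = σ x →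
      ((β₂ y : unitSubmonoid C.k C.K) : C.K) = σ ((β₂ x : unitSubmonoid C.k C.K) : C.K))
    {a₁ a₂ : ℕ → ℕ}
    (ha₁ : ∀ (x : unitSubmonoid C.k C.K) (m : ℕ), 0 < m → (x : C.K) ^ m = 1 →
      ((β₁ x : unitSubmonoid C.k C.K) : C.K) = (x : C.K) ^ a₁ m)
    (ha₂ : ∀ (x : unitSubmonoid C.k C.K) (m : ℕ), 0 < m → (x : C.K) ^ m = 1 →
      ((β₂ x : unitSubmonoid C.k C.K) : C.K) = (x : C.K) ^ a₂ m)
    (hmod : ∀ m : ℕ, 0 < m → a₁ m ≡ a₂ m [MOD m]) : β₁ = β₂ :=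
  C.equivariant_unitHom_eq_of_rootsOfUnity β₁ β₂ h₁ h₂ fun x m hm hxm =>
    Subtype.ext (by rw [ha₁ x m hm hxm, ha₂ x m hm hxm, C.pow_eq_pow_of_modEq hxm (hmod m hm)])

/-- **`Aut = Ẑ^× ⊂ Ẑ = End`**: an equivariant endomorphism of `𝒪_k̄^×` is bijective iff its exponent system is a
UNIT system (`a n` prime to `n` for every `n ≥ 1`).  (⇒: a bijective `β` maps primitive roots to primitive
roots; ⇐: `MLFClosure.exists_equivariant_unitMulEquiv_of_compatible` provides an equivariant AUTOMORPHISM with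
the same action on `μ_∞`, equal to `β` by the endomorphism uniqueness.)
[cite: MochizukiAbsTopIII2015, Proposition 3.3 (ii) p.74] -/
theorem MLFClosure.equivariant_unitHom_bijective_iff_coprime
    (β : unitSubmonoid C.k C.K →* unitSubmonoid C.k C.K)
    (hβ : ∀ (σ : C.K ≃ₐ[C.k] C.K) (x y : unitSubmonoid C.k C.K), (y : C.K) = σ x →
      ((β y : unitSubmonoid C.k C.K) : C.K) = σ ((β x : unitSubmonoid C.k C.K) : C.K))
    {a : ℕ → ℕ} (ha : ∀ m n : ℕ, 0 < m → 0 < n → m ∣ n → a n ≡ a m [MOD m])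
    (hβa : ∀ (x : unitSubmonoid C.k C.K) (m : ℕ), 0 < m → (x : C.K) ^ m = 1 →
      ((β x : unitSubmonoid C.k C.K) : C.K) = (x : C.K) ^ a m) :
    Function.Bijective β ↔ ∀ n, 0 < n → (a n).Coprime n := by
  classical
  constructor
  · intro hbij n hn
    haveI : NeZero n := ⟨hn.ne'⟩
    obtain ⟨ζ, hζ⟩ := C.exists_isPrimitiveRoot n hn
    set z : unitSubmonoid C.k C.K := ⟨ζ, C.rootOfUnity_mem_unitSubmonoid hn hζ.pow_eq_one⟩ with hz
    have hzM : IsPrimitiveRoot z n :=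
      (IsPrimitiveRoot.map_iff_of_injective (f := (unitSubmonoid C.k C.K).subtype)
        Subtype.val_injective).mp hζ
    have hβz : IsPrimitiveRoot (β z) n :=
      (IsPrimitiveRoot.map_iff_of_injective (f := β) hbij.1).mpr hzM
    have hβz' : IsPrimitiveRoot (((β z : unitSubmonoid C.k C.K)) : C.K) n :=
      (IsPrimitiveRoot.map_iff_of_injective (f := (unitSubmonoid C.k C.K).subtype)
        Subtype.val_injective).mpr hβz
    rw [hβa z n hn hζ.pow_eq_one] at hβz'
    exact (hζ.pow_iff_coprime hn (a n)).mp hβz'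
  · intro hcop
    obtain ⟨β', hβ'σ, hβ'μ, -⟩ := C.exists_equivariant_unitMulEquiv_of_compatible a ha hcop
    have heq : β = β'.toMonoidHom :=
      C.equivariant_unitHom_eq_of_rootsOfUnity β β'.toMonoidHom hβ
        (fun σ x y hyx => hβ'σ σ x y hyx)
        (fun x m hm hxm => Subtype.ext (by
          rw [hβa x m hm hxm, MulEquiv.coe_toMonoidHom, hβ'μ x m hm hxm]))
    rw [heq]
    exact β'.bijective

/-! ### §2 Endomorphisms of the model `TCG`-pair covering the identity of `G_k` -/

namespace GaloisMonoidPair.Hom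

variable {C : MLFClosure.{u}} {D : ModelMLFGaloisData C.k C.K} (φ ψ : GaloisMonoidPair.Hom D.tcgPair D.tcgPair)
  (hφ : ∀ g : D.Pi, D.aug (φ.homPi g) = D.aug g) (hψ : ∀ g : D.Pi, D.aug (ψ.homPi g) = D.aug g)

include hφ in
/-- Over `id_{G_k}`, `φ_M` is `Gal(k̄/k)`-equivariant in the shape used by `EquivariantUnitEndomorphisms`:
`y = σ x ⟹ φ_M y = σ (φ_M x)`. [cite: MochizukiAbsTopIII2015, Definition 3.1 (ii) p.67] -/
theorem tcg_homM_equivariant_of_overId (σ : C.K ≃ₐ[C.k] C.K) (x y : ↥(unitSubmonoid C.k C.K))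
    (hyx : (y : C.K) = σ x) :
    ((φ.homM y : ↥(unitSubmonoid C.k C.K)) : C.K) = σ ((φ.homM x : ↥(unitSubmonoid C.k C.K)) : C.K) := by
  obtain ⟨g, rfl⟩ := D.aug_surjective σ
  have hc : ∀ (g : D.Pi) (m : ↥(unitSubmonoid C.k C.K)),
      ((g • m : ↥(unitSubmonoid C.k C.K)) : C.K) = D.aug g • (m : C.K) := fun _ _ => rfl
  have hy : y = g • x := Subtype.ext (by rw [hc, hyx, AlgEquiv.smul_def])
  have h := congrArg Subtype.val (φ.smul_comm g x)
  rw [hc, hφ, ← hy, AlgEquiv.smul_def] at h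
  exact h

include hφ in
/-- **Over `id_{G_k}`, `φ_M` is a `Ẑ`-power**: there is a compatible exponent system `a` with `φ_M ζ = ζ^{a m}` on
`μ_m` and `φ_M x ∈ x^{a n}·(k⟮x⟯^×)^n` for all `n ≥ 1`. [cite: MochizukiAbsTopIII2015, Proposition 3.3 (ii) p.74] -/
theorem tcg_exists_exponents_of_overId :
    ∃ a : ℕ → ℕ, (∀ m n : ℕ, 0 < m → 0 < n → m ∣ n → a n ≡ a m [MOD m]) ∧
      (∀ (x : ↥(unitSubmonoid C.k C.K)) (m : ℕ), 0 < m → (x : C.K) ^ m = 1 →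
        ((φ.homM x : ↥(unitSubmonoid C.k C.K)) : C.K) = (x : C.K) ^ a m) ∧
      ∀ (x : ↥(unitSubmonoid C.k C.K)) (n : ℕ), 0 < n → ∃ w ∈ C.k⟮(x : C.K)⟯, w ≠ 0 ∧
        ((φ.homM x : ↥(unitSubmonoid C.k C.K)) : C.K) = (x : C.K) ^ a n * w ^ n :=
  C.equivariant_unitHom_eq_zhatPow φ.homM (tcg_homM_equivariant_of_overId φ hφ)

include hφ hψ in
/-- **Over `id_{G_k}`, `φ_M` is determined by its action on `μ_∞`** (`End ↪ Ẑ`): two endomorphisms of the model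
`TCG`-pair covering the identity whose monoid components agree on the roots of unity have the same monoid
component. [cite: MochizukiAbsTopIII2015, Proposition 3.3 (ii) p.74] -/
theorem tcg_homM_eq_of_rootsOfUnity_of_overId
    (hμ : ∀ (x : ↥(unitSubmonoid C.k C.K)) (m : ℕ), 0 < m → (x : C.K) ^ m = 1 → φ.homM x = ψ.homM x) :
    φ.homM = ψ.homM :=
  C.equivariant_unitHom_eq_of_rootsOfUnity φ.homM ψ.homM (tcg_homM_equivariant_of_overId φ hφ)
    (tcg_homM_equivariant_of_overId ψ hψ) hμ

include hφ in
/-- **Over `id_{G_k}`, `φ` is a `T`-isomorphism iff its exponent system is a unit system** (`Aut = Ẑ^× ⊂ Ẑ = End`):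
the «bijection with `Isom(μ_Ẑ(M), μ_Ẑ(M*))`» clause of Prop. 3.3 (ii) `TCG`, over the identity, among all
endomorphisms of `𝒞^MLF_TCG`. [cite: MochizukiAbsTopIII2015, Proposition 3.3 (ii) p.74] -/
theorem tcg_isTIso_iff_coprime_of_overId {a : ℕ → ℕ}
    (ha : ∀ m n : ℕ, 0 < m → 0 < n → m ∣ n → a n ≡ a m [MOD m])
    (hφa : ∀ (x : ↥(unitSubmonoid C.k C.K)) (m : ℕ), 0 < m → (x : C.K) ^ m = 1 →
      ((φ.homM x : ↥(unitSubmonoid C.k C.K)) : C.K) = (x : C.K) ^ a m) :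
    φ.IsTIso ↔ ∀ n, 0 < n → (a n).Coprime n :=
  C.equivariant_unitHom_bijective_iff_coprime φ.homM (tcg_homM_equivariant_of_overId φ hφ) ha hφa

end GaloisMonoidPair.Hom

end Literature.AnabelianGeometry.AbsoluteAnabelian

end
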